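import Summits.QuantumFields.BalabanUV.T4Continuum.Spine.NE7.QLaCensusTreeDecay

/-!
# Spine/NE7/QLaCensusTorusMultiplicity — NODE S's ledger census `T4RecentScale.Multiplicity` ON THE CELL'S TORI from a ledger in
# the PRINTED format: scale-`j` entries = torus localization domains of `T^{(j)}` with weights `≤ E₀·exp(−κ·d_j)`, `κ ≥ κ₀(4·2^d, 2d)`

Cell `pub-balaban-gaps` (YM blitz Y1, track G2, seat `ne7`, generation 11); text of record
`run/shared/lean/pub/pub-balaban-gaps/ne/NE7.md` (v11, census R69).  44th `Spine/NE7/` file; 0 `def`, 0 sorry.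

WHY.  File 36 turns a per-cube census `hcell` into `T4RecentScale.Multiplicity fac sc w Cw vol Λ K` on any scale-indexed cell types of
size `≤ vol·Λ^{K−j}` (`multiplicity_of_perCell_census`), and file 42 proves the per-cube census in print's decay format on the torus cubes
`TPt d N = Fin d → ZMod N` (`perCell_census_of_torusTreeDecay_K₀`, straight from the tree's (1.26) `TreeLengthTorus.ineq126_torus`).  The
cell's tori `Setup.Site P j = Fin P.d → ZMod (P.sitesPerDir j)` ARE such torus cube types, scale by scale, and file 36's count
`card_site_eq_unit_mul_real` is their normalisation.  This file composes the two: **`multiplicity_of_torusTreeDecay_sites`** — a ledger whose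
scale-`j` entries are pairwise-distinct torus localization domains of `T^{(j)}` (`TFaceConnected`, non-empty) with
`0 ≤ w_i ≤ E₀·exp(−κ·torusTreeLen (cells (sc i) i))` and `κ ≥ kappa₀ (4·2^d) (2d)` satisfies
`Multiplicity fac sc w (E₀·K₀(4·2^d, 2d)) |T^{(K)}| L^d K`.  Which lattice `T^{(j)}` indexes the scale-`j` cubes of a Bałaban ledger (the
`M`-cube lattice of [Balaban1987RG1] p. 257 is `T^{(j+m)}_M`-centred) is the consumer's re-indexing of `sc`; nothing here fixes it.  §2 `qla_of_torusTreeDecay` = file 36's END FACE `qla_of_logQuotient` with the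
`Multiplicity` binder so discharged: W-fmt@1 data per entry + the printed-format ledger ⟹ `Spine.NE7.QLa … (2·l₀·Cd·E₀·K₀) (θ²·L^d)`.

HONEST FRAMING.  A composition of files 36 and 42 by name; [folklore]; the printed decay format is a HYPOTHESIS, no object of Bałaban's
(2.18) [III] is constructed (NODE O).  NE7 NOT proved; spine 0∕9; one fixed finite T⁴ — NOT ℝ⁴, NOT infinite volume, NOT a mass gap, NOT
Clay.  No classification word moves (R10).
-/

noncomputable section

open MeasureTheory Finset
open scoped BigOperators

namespace Summit.QuantumFields.BalabanUV.T4Continuum.Spine.NE7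

open Literature.MathematicalPhysics.QuantumFieldTheory.Balaban1983to89
open Literature.MathematicalPhysics.QuantumFieldTheory.Balaban1983to89.TreeLengthTorus (TFaceConnected torusTreeLen)
open Literature.MathematicalPhysics.QuantumFieldTheory.Balaban1983to89.B12TreeDecay (kappa₀ K₀ K₀_pos)
open Literature.MathematicalPhysics.QuantumFieldTheory.Balaban1983to89.T4RecentScale (Multiplicity)

variable {ι : Type*} {P : Params}

/-- **THE LEDGER CENSUS ON THE CELL'S TORI FROM THE PRINTED DECAY FORMAT.**  Scale-`j` cells = sites of `T^{(j)}` (`Setup.Site P j`, a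
torus cube type `Fin P.d → ZMod (P.sitesPerDir j)`); (F-dom) every entry's cell family is a torus localization domain of its scale and
`cells j` is injective on the scale-`j` slice; (F-0.25) `0 ≤ w i ≤ E₀·exp(−κ·d_j(cells i))` with `κ ≥ κ₀(4·2^d, 2d)`.  Then
`Multiplicity fac sc w (E₀·K₀(4·2^d, 2d)) |T^{(K)}| (L^d) K` — file 42's `perCell_census_of_torusTreeDecay_K₀` scale by scale on the slice,
fed to file 36's `multiplicity_of_perCell_census` with the count `card_site_eq_unit_mul_real`. [folklore] -/
theorem multiplicity_of_torusTreeDecay_sites (fac : Finset ι) (sc : ι → ℕ) (cells : (j : ℕ) → ι → Finset (Site P j))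
    (w : ι → ℝ) {E₀ κ : ℝ} (hE : 0 ≤ E₀) (hκ : kappa₀ (4 * 2 ^ P.d) (2 * P.d) ≤ κ)
    (hdom : ∀ i ∈ fac, (cells (sc i) i).Nonempty ∧ TFaceConnected (cells (sc i) i))
    (hinj : ∀ j, Set.InjOn (cells j) ↑(fac.filter fun i => sc i = j)) (hw0 : ∀ i ∈ fac, 0 ≤ w i)
    (hw : ∀ i ∈ fac, w i ≤ E₀ * Real.exp (-κ * torusTreeLen (cells (sc i) i))) :
    Multiplicity fac sc w (E₀ * K₀ (4 * 2 ^ P.d) (2 * P.d)) (Fintype.card (Site P P.K)) ((P.L : ℝ) ^ P.d) P.K := by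
  classical
  refine multiplicity_of_perCell_census fac sc cells w (fun i hi => (hdom i hi).1) hw0 (fun j _ x => ?_)
    (fun j hj => (card_site_eq_unit_mul_real P hj).le) (mul_nonneg hE (K₀_pos _ _).le)
  -- the scale-`j` slice as a ledger of its own, read at scale `j`
  set sl : Finset ι := fac.filter fun i => sc i = j with hsl
  have hsl' : sl.filter (fun i => sc i = j) = sl := by
    ext i
    simp only [hsl, mem_filter, and_assoc, and_self]
  have hdom' : ∀ i ∈ sl, (cells j i).Nonempty ∧ TFaceConnected (cells j i) := by
    intro i hi
    obtain ⟨hif, hij⟩ := mem_filter.mp hi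
    subst hij
    exact hdom i hif
  have hinj' : ∀ j', Set.InjOn (cells j) ↑(sl.filter fun i => sc i = j') := by
    intro j' a ha b hb h
    have ha' : a ∈ sl := (mem_filter.mp ha).1
    have hb' : b ∈ sl := (mem_filter.mp hb).1
    exact hinj j (by simpa [hsl] using ha') (by simpa [hsl] using hb') h
  have hw' : ∀ i ∈ sl, w i ≤ E₀ * Real.exp (-κ * torusTreeLen (cells j i)) := by
    intro i hi
    obtain ⟨hif, hij⟩ := mem_filter.mp hi
    subst hij
    exact hw i hif
  have h := perCell_census_of_torusTreeDecay_K₀ (d := P.d) (N := P.sitesPerDir j) sl sc (fun _ => cells j) w hE hκ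
    hdom' hinj' hw' j x
  rw [hsl'] at h
  exact h

section EndFace

variable {Ω : Type*} [MeasurableSpace Ω]

/-- **NODE S's END FACE WITH THE CENSUS IN THE PRINTED FORMAT** — file 36's `qla_of_logQuotient` with its `Multiplicity` binder
DISCHARGED by `multiplicity_of_torusTreeDecay_sites`: per ledger entry the W-fmt@1 data (two probability laws, one rider `G X` with
`|G X| ≤ s X` a.e., the identity `c_t − c_0 = log∫e^{tG}dν₁ − log∫e^{tG}dν₂`, the defect size `s X ≤ Cd·wt X·(θ^{K − sc X})²`), and for the
weights `wt` the PRINTED format on the cell's tori (scale-`j` cells = torus localization domains of `T^{(j)}`, pairwise distinct per scale,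
`0 ≤ wt X ≤ E₀·exp(−κ·d_j(cells X))`, `κ ≥ κ₀(4·2^d, 2d)`) ⟹ `Spine.NE7.QLa wf sc ct c0 K |T^{(K)}| (2·l₀·Cd·E₀·K₀(4·2^d, 2d)) (θ²·L^d)`
(`K = P.K`; in d = 4 with `θ = L^{−3}`: ratio `θ²L⁴ = L⁻²`). [folklore] -/
theorem qla_of_torusTreeDecay {wf : Finset ι} {sc : ι → ℕ} {wt ct c0 : ι → ℝ} {l₀ Cd θ t E₀ κ : ℝ}
    (ht : |t| ≤ l₀) (hCd : 0 ≤ Cd) (hwt : ∀ X ∈ wf, 0 ≤ wt X)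
    (ν₁ ν₂ : ι → Measure Ω) [∀ X, IsProbabilityMeasure (ν₁ X)] [∀ X, IsProbabilityMeasure (ν₂ X)] (G : ι → Ω → ℝ)
    (hG₁ : ∀ X ∈ wf, AEStronglyMeasurable (G X) (ν₁ X)) (hG₂ : ∀ X ∈ wf, AEStronglyMeasurable (G X) (ν₂ X)) (s : ι → ℝ)
    (hb₁ : ∀ X ∈ wf, ∀ᵐ ω ∂(ν₁ X), |G X ω| ≤ s X) (hb₂ : ∀ X ∈ wf, ∀ᵐ ω ∂(ν₂ X), |G X ω| ≤ s X)
    (hfmt : ∀ X ∈ wf, ct X - c0 X =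
      Real.log (∫ ω, Real.exp (t * G X ω) ∂(ν₁ X)) - Real.log (∫ ω, Real.exp (t * G X ω) ∂(ν₂ X)))
    (hs : ∀ X ∈ wf, s X ≤ Cd * wt X * (θ ^ (P.K - sc X)) ^ 2)
    (cells : (j : ℕ) → ι → Finset (Site P j)) (hE : 0 ≤ E₀) (hκ : kappa₀ (4 * 2 ^ P.d) (2 * P.d) ≤ κ)
    (hdom : ∀ X ∈ wf, (cells (sc X) X).Nonempty ∧ TFaceConnected (cells (sc X) X))
    (hinj : ∀ j, Set.InjOn (cells j) ↑(wf.filter fun X => sc X = j))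
    (hw : ∀ X ∈ wf, wt X ≤ E₀ * Real.exp (-κ * torusTreeLen (cells (sc X) X))) :
    QLa wf sc ct c0 P.K (Fintype.card (Site P P.K)) (2 * l₀ * Cd * (E₀ * K₀ (4 * 2 ^ P.d) (2 * P.d)))
      (θ ^ 2 * (P.L : ℝ) ^ P.d) :=
  qla_of_logQuotient ht hCd hwt ν₁ ν₂ G hG₁ hG₂ s hb₁ hb₂ hfmt hs
    (multiplicity_of_torusTreeDecay_sites wf sc cells wt hE hκ hdom hinj hwt hw)

end EndFace

end Summit.QuantumFields.BalabanUV.T4Continuum.Spine.NE7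

end
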